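import Mathlib
import Summits.AtomisticToContinuum.HydrodynamicLimit.Theorems.ImplosionDichotomyDenseExcursionR2IsentropicReduction

/-!
# The exact self-similar member — stub `stub_exactSelfSimilar` (N1)

Crux `Summit.AtomisticToContinuum.HydrodynamicLimit.Theses.ImplosionDichotomy.DenseExcursion`
(stmt-AtomisticToContinuum-12586), line `r2-one-mode-two-conditions`, registered stub
`stub_exactSelfSimilar : ExactSelfSimilar` (skeleton v6 §0c-3; defs module
`…Theorems.ImplosionDichotomyDenseExcursionR2SelfSimilar`, reduction
`…Theorems.ImplosionDichotomyDenseExcursionR2IsentropicReduction`).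

**Mathematics.** A globally smooth monatomic profile `(W, S)` (`IsMonatomicProfile r W S`) together with its
ORIGINAL-FORM equations `(W - 1) W' + 3 S S' = r W - W² - 3 S²`, `(1 - W) S' - (S/3) W' = S (2W - r)` is a STEADY
solution of the ideal (`Z ≡ 1`) self-similar system in the r2 variables: for the `τ`-INDEPENDENT pair
`(w, sf)(τ, x) := (W x, S x)` one has, at `p = logPt z = (τ, log ‖ζ‖)`, `∂_τ w = ∂_τ sf = 0` and
`∂ₓ w = W'(p.2)`, `∂ₓ sf = S'(p.2)` (chain rule through `Prod.snd`, `exact_dτ_dx_of_snd`), so the two right-hand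
sides of the landed equivalence `stub_isentropicReduction` (p105814) are
`(W - 1) W' + 3 S S' + W² - r W + 3 S² = 0` and `(W - 1) S' + (S/3) W' + S (2W - r) = 0` at `x = log ‖ζ‖` — the two
profile equations. Differentiability of `W, S` comes from `ContDiff ℝ ∞`, positivity of `sf` from `S > 0`.
Folklore calculus; no cited facts.
-/

noncomputable section

open Filter Set
open scoped Topology ContDiff

namespace Summit.AtomisticToContinuum.HydrodynamicLimit.Theorems.R2OneModeTwoConditions

open Literature.MathematicalPhysics.KineticTheory (V3)

/-! ## The statement (verbatim: skeleton v6 §0c-3) -/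

/-- Statement of `stub_exactSelfSimilar` (N1): a monatomic profile with its original-form equations IS a steady solution of
the ideal self-similar system in the r2 variables — for every `τ`, every `ζ ≠ 0`, every `C > 0` and all `D, H`, the isentropic
radial fields built from the `τ`-INDEPENDENT pair `(w, sf)(τ, x) := (W x, S x)` satisfy `SelfSimEulerZAt r D H 1`. (From
`stub_isentropicReduction`: `dτ` of a `τ`-constant field is `0`, `dx` is `deriv`, and the two right-hand sides vanish by the
profile equations.) With `stub_selfSimilarCovariance` this is the exact self-similar implosion in physical variables on the
punctured backward cone. -/
def ExactSelfSimilar : Prop :=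
  ∀ (r : ℝ) (W S : ℝ → ℝ), IsMonatomicProfile r W S →
    (∀ x, (W x - 1) * deriv W x + 3 * S x * deriv S x = r * W x - W x ^ 2 - 3 * S x ^ 2 ∧
      (1 - W x) * deriv S x - S x / 3 * deriv W x = S x * (2 * W x - r)) →
    ∀ (C : ℝ) (D H : ℝ → ℝ) (z : ℝ × V3), 0 < C → z.2 ≠ 0 →
      SelfSimEulerZAt r D H (fun _ => 1) (isenDensity C (fun p => S p.2)) (isenTemperature (fun p => S p.2))
        (radVelocity (fun p => W p.2)) z

/-! ## `τ`-independent scalar fields -/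

/-- **Chain rule through `Prod.snd`.** For a `τ`-INDEPENDENT scalar field `(τ, x) ↦ f x` with `f` differentiable
at `p.2`: `∂_τ (f ∘ snd)(p) = 0` and `∂ₓ (f ∘ snd)(p) = f'(p.2)` (`D(f ∘ snd)(p) = f'(p.2) • snd`). [folklore] -/
theorem exact_dτ_dx_of_snd {f : ℝ → ℝ} (p : ℝ × ℝ) (hf : DifferentiableAt ℝ f p.2) :
    dτ (fun q : ℝ × ℝ => f q.2) p = 0 ∧ dx (fun q : ℝ × ℝ => f q.2) p = deriv f p.2 := by
  have h : HasFDerivAt (fun q : ℝ × ℝ => f q.2) (deriv f p.2 • ContinuousLinearMap.snd ℝ ℝ ℝ) p :=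
    hf.hasDerivAt.comp_hasFDerivAt p hasFDerivAt_snd
  unfold dτ dx
  rw [h.fderiv]
  simp

/-! ## The exact self-similar member (N1) -/

/-- **STUB N1 of the line `r2-one-mode-two-conditions` (`stub_exactSelfSimilar`), PROVED.** A globally smooth
monatomic profile `(W, S)` with its original-form equations `(W - 1) W' + 3 S S' = r W - W² - 3 S²`,
`(1 - W) S' - (S/3) W' = S (2W - r)` is a STEADY solution of the ideal self-similar system in the r2 variables:
for every `C > 0`, all `D, H` and every `z = (τ, ζ)` with `ζ ≠ 0`, the isentropic radial fields of the
`τ`-independent pair `(w, sf)(τ, x) := (W x, S x)` satisfy `SelfSimEulerZAt r D H 1`. Proof: the `.mpr` direction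
of the landed `stub_isentropicReduction` (differentiability from `ContDiff ℝ ∞ W`, `ContDiff ℝ ∞ S`, positivity
from `S > 0`); by `exact_dτ_dx_of_snd` the `τ`-derivatives vanish and the `x`-derivatives are `W'`, `S'` at
`x = log ‖ζ‖`, where both right-hand sides vanish by the two profile equations. [folklore] -/
theorem stub_exactSelfSimilar : ExactSelfSimilar := by
  intro r W S hP hE C D H z hC hz
  obtain ⟨-, -, hW, hS, hSpos, -⟩ := hP
  have hWd : DifferentiableAt ℝ W (logPt z).2 := (hW.differentiable (by simp)) _
  have hSd : DifferentiableAt ℝ S (logPt z).2 := (hS.differentiable (by simp)) _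
  have hWd2 : DifferentiableAt ℝ (fun p : ℝ × ℝ => W p.2) (logPt z) :=
    hWd.comp (logPt z) differentiableAt_snd
  have hSd2 : DifferentiableAt ℝ (fun p : ℝ × ℝ => S p.2) (logPt z) :=
    hSd.comp (logPt z) differentiableAt_snd
  refine (stub_isentropicReduction r C D H (fun p => W p.2) (fun p => S p.2) z hz hC hWd2 hSd2
    (hSpos _)).mpr ?_
  obtain ⟨hWt, hWx⟩ := exact_dτ_dx_of_snd (logPt z) hWd
  obtain ⟨hSt, hSx⟩ := exact_dτ_dx_of_snd (logPt z) hSd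
  obtain ⟨h1, h2⟩ := hE (logPt z).2
  refine ⟨?_, ?_⟩
  · rw [hWt, hWx, hSx]
    linear_combination -h1
  · rw [hSt, hSx, hWx]
    linear_combination h2

end Summit.AtomisticToContinuum.HydrodynamicLimit.Theorems.R2OneModeTwoConditions

end
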